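import Mathlib
import HarnessLib
import Summits.NavierStokesRegularity.NavierStokesRegularity.Theorems.HalfSpaceWindowDoorCirculationCarryingRigidityGaussExtremalTiltingSharp

/-!
# Route `HalfSpaceWindowDoor`, crux `CirculationCarryingRigidity` (stmt-NavierStokesRegularity-25311) —
# the STRETCHING FORM of the Gaussian tilting moment (horizontal vorticity eliminated):
# `𝒯_t(x₀)[u] = ∫G_t g ∂₃u₃ − (1/2t)∫G_t (x−x₀)₃ u₃ g`, and «the extremal enemy stretches its angular momentum»

LEAD ns-hsw-p1 g8 (cell pub-ns-dss), `--supports stmt-NavierStokesRegularity-25311 --as helper`; sequel of `…GaussExtremalTiltingSharp`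
(tilting window `(2 − 2C)M₀ ≤ 𝒯 ≤ (2 + 2C)M₀` at the Gaussian-extremal point).  The Gaussian TILTING moment
`𝒯_t(x₀)[u] = ∫ G_t(x−x₀) ((x−x₀)_h·ω_h) u₃ dx` (`ω = curl u`) seems to require the horizontal vorticity, on which the closed-hemisphere
class has no control.  It does not: pointwise `(x−x₀)_h·ω_h = ∂_θu₃ − ∂₃g` with `g = (x−x₀)₀u₁ − (x−x₀)₁u₀` the axial angular-momentum
density and `∂_θ = (x−x₀)₀∂₁ − (x−x₀)₁∂₀`, and the `∂_θ`-term integrates to zero against the radial Gaussian (`G u₃∂_θu₃ = ½G∂_θ(u₃²)`).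
One more Gaussian integration by parts in `x₃` gives the KINEMATIC IDENTITY (every bounded `C¹` field with bounded gradient, every
`t > 0`, `x₀`):

* `gaussTilting_eq_stretching` — **`𝒯_t(x₀)[u] = ∫ G_t(x−x₀) g ∂₃u₃ dx − (1/2t) ∫ G_t(x−x₀) (x−x₀)₃ u₃ g dx`**: the tilting moment IS the
  Gaussian correlation of the angular-momentum density with the AXIAL STRETCHING `∂₃u₃`, corrected by the axial transport of angular
  momentum towards the plane `x₃ = (x₀)₃` (workhorse `integral_G_coord_mul_fderiv`: `∫G (x−x₀)ᵢ∂ⱼψ = (1/2t)∫G (x−x₀)ⱼ(x−x₀)ᵢψ`, `i ≠ j`).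
* `gaussExtremal_stretching` — at the Gaussian-extremal point of (an extremal profile of) every enemy of W6 with constant `C`, with
  `u = W(−1)`, `M₀ = ∫G₁ω₃ = ½∫G₁g > 0`:  **`(2 − 2C)·M₀ ≤ ∫G₁ g ∂₃u₃ − ½∫G₁ x₃u₃g ≤ (2 + 2C)·M₀`** — for `C < 1` the enemy's angular
  momentum about the extremal axis is, in Gaussian mean, being axially STRETCHED (`g∂₃u₃ > 0` on balance, after the transport
  correction): the classical vortex-stretching mechanism is not optional for the enemy but pinned at a definite scale-invariant rate.
* `hemisphereLiouvilleE3_of_stretching`, `circulationCarryingRigidity_of_stretching` — the corresponding reductions.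

WHAT THIS IS NOT: not a statement about Navier–Stokes regularity; door statements concern HYPOTHETICAL blow-up profiles (KNSS ancient
mild solutions).  No item is closed by this file.
-/

noncomputable section

-- the summit and its single sub-problem share the name (CONVENTIONS §1), as in every Theorems file
set_option linter.dupNamespace false

namespace Summit.NavierStokesRegularity.NavierStokesRegularity.Theorems.HalfSpaceWindowDoorCirculationCarryingRigidityGaussExtremalStretching

open MeasureTheory Set Function Filter Topology
open scoped RealInnerProductSpace InnerProductSpace
open Literature.Analysis Literature.Analysis.FluidPDE Literature.Analysis.UnboundedOperators
open Summit.NavierStokesRegularity.NavierStokesRegularity.Theses.HalfSpaceWindowDoor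
open Summit.NavierStokesRegularity.NavierStokesRegularity.Theorems.HalfSpaceWindowDoorCirculationCarryingRigidityDefs
open Summit.NavierStokesRegularity.NavierStokesRegularity.Theorems.HalfSpaceWindowDoorCirculationCarryingRigidityReduction
  (circulationCarryingRigidity_of_hemisphereLiouvilleE3)
open Summit.NavierStokesRegularity.NavierStokesRegularity.Theorems.HalfSpaceWindowDoorCirculationCarryingRigidityGaussKernel
open Summit.NavierStokesRegularity.NavierStokesRegularity.Theorems.HalfSpaceWindowDoorCirculationCarryingRigidityGaussCirculation
  (integral_G_angMom_eq)
open Summit.NavierStokesRegularity.NavierStokesRegularity.Theorems.HalfSpaceWindowDoorCirculationCarryingRigidityGaussExtremalTiltingSharp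
  (gaussExtremal_tilting_sharp)
open Summit.NavierStokesRegularity.NavierStokesRegularity.Theorems.LocalSineTubeDoorProfileAlignedWindowRigidityAncient
  (bdd_of_hasTypeITimeDecay analyticOnNhd_slice)
open Summit.NavierStokesRegularity.NavierStokesRegularity.Theorems.PoloidalWindowDoorPoloidalWindowRigidityClassSpaceTimeRates
  (exists_fderiv_rate_of_class')

section Kinematics

variable {u : EuclideanSpace ℝ (Fin 3) → EuclideanSpace ℝ (Fin 3)} {t : ℝ} (x₀ : EuclideanSpace ℝ (Fin 3))

/-- Product rule for a coordinate weight: `∂ⱼ((x−x₀)ᵢ ψ) = δᵢⱼ ψ + (x−x₀)ᵢ ∂ⱼψ`. -/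
theorem fderiv_coord_mul_apply {ψ : EuclideanSpace ℝ (Fin 3) → ℝ} (hψ : Differentiable ℝ ψ) (i j : Fin 3)
    (x : EuclideanSpace ℝ (Fin 3)) :
    fderiv ℝ (fun y => (y - x₀) i * ψ y) x (EuclideanSpace.single j 1) =
      (if i = j then 1 else 0) * ψ x + (x - x₀) i * fderiv ℝ ψ x (EuclideanSpace.single j 1) := by
  have h : HasFDerivAt (fun y => (y - x₀) i * ψ y)
      ((x - x₀) i • fderiv ℝ ψ x + ψ x • EuclideanSpace.proj (𝕜 := ℝ) i) x :=
    (hasFDerivAt_coord x₀ x i).mul (hψ x).hasFDerivAt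
  have hp : ∀ w : EuclideanSpace ℝ (Fin 3), EuclideanSpace.proj (𝕜 := ℝ) i w = w i := fun w => rfl
  rw [h.fderiv]
  simp only [add_apply, smul_apply, smul_eq_mul, hp, PiLp.single_apply]
  split_ifs with hij
  · subst hij; ring
  · ring

/-- Norm of the derivative of a coordinate-weighted scalar: `‖D((x−x₀)ᵢψ)(x)‖ ≤ P + Q‖x − x₀‖` if `|ψ| ≤ P`, `‖Dψ‖ ≤ Q`. -/
theorem norm_fderiv_coord_mul_le {ψ : EuclideanSpace ℝ (Fin 3) → ℝ} (hψ : Differentiable ℝ ψ) {P Q : ℝ} (hP : ∀ x, ‖ψ x‖ ≤ P)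
    (hQ : ∀ x, ‖fderiv ℝ ψ x‖ ≤ Q) (i : Fin 3) (x : EuclideanSpace ℝ (Fin 3)) :
    ‖fderiv ℝ (fun y => (y - x₀) i * ψ y) x‖ ≤ P + Q * ‖x - x₀‖ := by
  have hP0 : 0 ≤ P := (norm_nonneg _).trans (hP x)
  have hQ0 : 0 ≤ Q := (norm_nonneg _).trans (hQ x)
  have h : HasFDerivAt (fun y => (y - x₀) i * ψ y)
      ((x - x₀) i • fderiv ℝ ψ x + ψ x • EuclideanSpace.proj (𝕜 := ℝ) i) x :=
    (hasFDerivAt_coord x₀ x i).mul (hψ x).hasFDerivAt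
  have hp : ∀ w : EuclideanSpace ℝ (Fin 3), EuclideanSpace.proj (𝕜 := ℝ) i w = w i := fun w => rfl
  rw [h.fderiv]
  refine ContinuousLinearMap.opNorm_le_bound _ (by positivity) fun w => ?_
  simp only [add_apply, smul_apply, smul_eq_mul, hp]
  have hy : |(x - x₀) i| ≤ ‖x - x₀‖ := abs_coord_le_norm_e3 _ i
  have hw : |w i| ≤ ‖w‖ := abs_coord_le_norm_e3 _ i
  have hD : |fderiv ℝ ψ x w| ≤ Q * ‖w‖ :=
    (Real.norm_eq_abs _).symm.le.trans ((ContinuousLinearMap.le_opNorm _ _).trans (mul_le_mul_of_nonneg_right (hQ x) (norm_nonneg _)))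
  have hψx : |ψ x| ≤ P := (Real.norm_eq_abs _).symm.le.trans (hP x)
  rw [Real.norm_eq_abs]
  calc |(x - x₀) i * fderiv ℝ ψ x w + ψ x * w i| ≤ |(x - x₀) i * fderiv ℝ ψ x w| + |ψ x * w i| := abs_add_le _ _
    _ = |(x - x₀) i| * |fderiv ℝ ψ x w| + |ψ x| * |w i| := by rw [abs_mul, abs_mul]
    _ ≤ ‖x - x₀‖ * (Q * ‖w‖) + P * ‖w‖ :=
        add_le_add (mul_le_mul hy hD (abs_nonneg _) (norm_nonneg _)) (mul_le_mul hψx hw (abs_nonneg _) hP0)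
    _ = (P + Q * ‖x - x₀‖) * ‖w‖ := by ring

/-- **Workhorse Gaussian integration by parts with one coordinate weight** (`i ≠ j`, `ψ ∈ C¹` bounded with bounded gradient, `t > 0`):
`∫ G_t(x−x₀) (x−x₀)ᵢ ∂ⱼψ dx = (1/2t) ∫ G_t(x−x₀) (x−x₀)ⱼ (x−x₀)ᵢ ψ dx` (from `∫G∂ⱼφ = −∫∂ⱼG φ` with `φ = (x−x₀)ᵢψ`,
`∂ⱼ(x−x₀)ᵢ = 0`, `∂ⱼG = −(x−x₀)ⱼG/2t`), together with the integrability of both integrands. -/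
theorem integral_G_coord_mul_fderiv {ψ : EuclideanSpace ℝ (Fin 3) → ℝ} (hψ : ContDiff ℝ 1 ψ) {P Q : ℝ} (hP : ∀ x, ‖ψ x‖ ≤ P)
    (hQ : ∀ x, ‖fderiv ℝ ψ x‖ ≤ Q) (ht : 0 < t) {i j : Fin 3} (hij : i ≠ j) :
    Integrable (fun x => heatKernel t (x - x₀) * ((x - x₀) i * fderiv ℝ ψ x (EuclideanSpace.single j 1))) ∧
    Integrable (fun x => heatKernel t (x - x₀) * ((x - x₀) j * ((x - x₀) i * ψ x))) ∧
    ∫ x, heatKernel t (x - x₀) * ((x - x₀) i * fderiv ℝ ψ x (EuclideanSpace.single j 1)) =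
      1 / (2 * t) * ∫ x, heatKernel t (x - x₀) * ((x - x₀) j * ((x - x₀) i * ψ x)) := by
  have hψd : Differentiable ℝ ψ := hψ.differentiable one_ne_zero
  set φ : EuclideanSpace ℝ (Fin 3) → ℝ := fun y => (y - x₀) i * ψ y with hφ_def
  have hφ : ContDiff ℝ 1 φ :=
    ((EuclideanSpace.proj (𝕜 := ℝ) i).contDiff.comp (contDiff_id.sub contDiff_const)).mul hψ
  have hP0 : 0 ≤ P := (norm_nonneg _).trans (hP x₀)
  have h0 : ∀ x, ‖φ x‖ ≤ 0 + P * ‖x - x₀‖ := fun x => by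
    rw [hφ_def, norm_mul, zero_add, mul_comm P]
    exact mul_le_mul ((Real.norm_eq_abs _).le.trans (abs_coord_le_norm_e3 _ i)) (hP x) (norm_nonneg _) (norm_nonneg _)
  have h1 : ∀ x, ‖fderiv ℝ φ x‖ ≤ P + Q * ‖x - x₀‖ := fun x => norm_fderiv_coord_mul_le x₀ hψd hP hQ i x
  obtain ⟨I1, I2, E⟩ := integral_G_mul_fderiv_eq_lin x₀ hφ h0 h1 ht j
  have hderiv : ∀ x, fderiv ℝ φ x (EuclideanSpace.single j 1) = (x - x₀) i * fderiv ℝ ψ x (EuclideanSpace.single j 1) := by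
    intro x
    rw [hφ_def, fderiv_coord_mul_apply x₀ hψd i j x, if_neg hij]
    ring
  have hG' : ∀ x, fderiv ℝ (fun y : EuclideanSpace ℝ (Fin 3) => heatKernel t (y - x₀)) x (EuclideanSpace.single j 1) * φ x =
      -(1 / (2 * t)) * (heatKernel t (x - x₀) * ((x - x₀) j * ((x - x₀) i * ψ x))) := by
    intro x; rw [fderiv_G_apply, hφ_def]; ring
  have hfun1 : (fun x => heatKernel t (x - x₀) * ((x - x₀) i * fderiv ℝ ψ x (EuclideanSpace.single j 1))) =
      fun x => heatKernel t (x - x₀) * fderiv ℝ φ x (EuclideanSpace.single j 1) := by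
    funext x; rw [hderiv]
  have hfun2 : (fun x => heatKernel t (x - x₀) * ((x - x₀) j * ((x - x₀) i * ψ x))) =
      fun x => -(2 * t) * (fderiv ℝ (fun y : EuclideanSpace ℝ (Fin 3) => heatKernel t (y - x₀)) x (EuclideanSpace.single j 1) * φ x) := by
    funext x; rw [hG']; field_simp
  have hfun3 : (fun x => fderiv ℝ (fun y : EuclideanSpace ℝ (Fin 3) => heatKernel t (y - x₀)) x (EuclideanSpace.single j 1) * φ x) =
      fun x => -(1 / (2 * t)) * (heatKernel t (x - x₀) * ((x - x₀) j * ((x - x₀) i * ψ x))) := funext hG'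
  refine ⟨by rw [hfun1]; exact I1, by rw [hfun2]; exact I2.const_mul _, ?_⟩
  rw [hfun1, E, hfun3, integral_const_mul]
  ring

/-- The derivative of a product of two components: `∂_w(uₐu_b) = (∂_w uₐ)u_b + uₐ(∂_w u_b)`. -/
theorem fderiv_comp_mul_comp (hud : Differentiable ℝ u) (a b : Fin 3) (x w : EuclideanSpace ℝ (Fin 3)) :
    fderiv ℝ (fun y => u y a * u y b) x w = fderiv ℝ u x w a * u x b + u x a * fderiv ℝ u x w b := by
  rw [fderiv_fun_mul (differentiable_apply3 hud a x) (differentiable_apply3 hud b x)]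
  simp only [add_apply, smul_apply, smul_eq_mul, fderiv_apply3 hud]
  ring

/-- A product of two components of a bounded `C¹` field with bounded gradient is `C¹`, bounded by `B²`, with gradient bounded by `2BM`. -/
theorem comp_mul_comp_bounds (hu : ContDiff ℝ 1 u) {B M : ℝ} (hB : ∀ x, ‖u x‖ ≤ B) (hM : ∀ x, ‖fderiv ℝ u x‖ ≤ M) (a b : Fin 3) :
    ContDiff ℝ 1 (fun y => u y a * u y b) ∧ (∀ x, ‖u x a * u x b‖ ≤ B ^ 2) ∧
      ∀ x, ‖fderiv ℝ (fun y => u y a * u y b) x‖ ≤ 2 * B * M := by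
  have hud : Differentiable ℝ u := hu.differentiable one_ne_zero
  have hB0 : 0 ≤ B := (norm_nonneg _).trans (hB 0)
  have hM0 : 0 ≤ M := (norm_nonneg _).trans (hM 0)
  have hc : ∀ i x, |u x i| ≤ B := fun i x => (abs_coord_le_norm_e3 _ i).trans (hB x)
  refine ⟨(contDiff_apply3 hu a).mul (contDiff_apply3 hu b), fun x => ?_, fun x => ?_⟩
  · rw [norm_mul, Real.norm_eq_abs, Real.norm_eq_abs, sq]
    exact mul_le_mul (hc a x) (hc b x) (abs_nonneg _) hB0
  · refine ContinuousLinearMap.opNorm_le_bound _ (by positivity) fun w => ?_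
    rw [fderiv_comp_mul_comp hud a b x w, Real.norm_eq_abs]
    have hD : ∀ i, |fderiv ℝ u x w i| ≤ M * ‖w‖ := fun i =>
      (abs_coord_le_norm_e3 _ i).trans ((ContinuousLinearMap.le_opNorm _ _).trans (mul_le_mul_of_nonneg_right (hM x) (norm_nonneg _)))
    calc |fderiv ℝ u x w a * u x b + u x a * fderiv ℝ u x w b|
        ≤ |fderiv ℝ u x w a * u x b| + |u x a * fderiv ℝ u x w b| := abs_add_le _ _
      _ = |fderiv ℝ u x w a| * |u x b| + |u x a| * |fderiv ℝ u x w b| := by rw [abs_mul, abs_mul]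
      _ ≤ (M * ‖w‖) * B + B * (M * ‖w‖) :=
          add_le_add (mul_le_mul (hD a) (hc b x) (abs_nonneg _) (by positivity)) (mul_le_mul (hc a x) (hD b) (abs_nonneg _) hB0)
      _ = 2 * B * M * ‖w‖ := by ring

/-- **THE STRETCHING FORM OF THE GAUSSIAN TILTING MOMENT** (kinematic identity; `u ∈ C¹` bounded with bounded gradient, `t > 0`, any `x₀`):
`∫ G_t(x−x₀) ((x−x₀)₀ω₀ + (x−x₀)₁ω₁) u₂ dx = ∫ G_t(x−x₀) g ∂₂u₂ dx − (1/2t) ∫ G_t(x−x₀) (x−x₀)₂ u₂ g dx`,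
`ω = curl u`, `g = (x−x₀)₀u₁ − (x−x₀)₁u₀` (`= angMom x₀ u`), `∂₂u₂ = Du(x)[e₂]₂`.  The horizontal vorticity is gone. -/
theorem gaussTilting_eq_stretching (hu : ContDiff ℝ 1 u) {B M : ℝ} (hB : ∀ x, ‖u x‖ ≤ B) (hM : ∀ x, ‖fderiv ℝ u x‖ ≤ M)
    (ht : 0 < t) :
    Integrable (fun x => heatKernel t (x - x₀) * (angMom x₀ u x * fderiv ℝ u x (EuclideanSpace.single 2 1) 2)) ∧
    Integrable (fun x => heatKernel t (x - x₀) * ((x - x₀) 2 * u x 2 * angMom x₀ u x)) ∧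
    ∫ x, heatKernel t (x - x₀) * (((x - x₀) 0 * curl u x 0 + (x - x₀) 1 * curl u x 1) * u x 2) =
      (∫ x, heatKernel t (x - x₀) * (angMom x₀ u x * fderiv ℝ u x (EuclideanSpace.single 2 1) 2)) -
        1 / (2 * t) * ∫ x, heatKernel t (x - x₀) * ((x - x₀) 2 * u x 2 * angMom x₀ u x) := by
  have hud : Differentiable ℝ u := hu.differentiable one_ne_zero
  have h01 : (0 : Fin 3) ≠ 1 := by decide
  have h10 : (1 : Fin 3) ≠ 0 := by decide
  have h02 : (0 : Fin 3) ≠ 2 := by decide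
  have h12 : (1 : Fin 3) ≠ 2 := by decide
  -- the three auxiliary scalars `ψ_A = u₂²`, `ψ₁ = u₂u₁`, `ψ₀ = u₂u₀`
  obtain ⟨hA, hA0, hA1⟩ := comp_mul_comp_bounds hu hB hM 2 2
  obtain ⟨hψ1, hψ10, hψ11⟩ := comp_mul_comp_bounds hu hB hM 2 1
  obtain ⟨hψ0, hψ00, hψ01⟩ := comp_mul_comp_bounds hu hB hM 2 0
  -- four Gaussian integrations by parts
  obtain ⟨IA1, JA1, EA1⟩ := integral_G_coord_mul_fderiv x₀ hA hA0 hA1 ht h01      -- `∫G y₀ ∂₁ψ_A = (1/2t)∫G y₁y₀ψ_A`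
  obtain ⟨IA2, JA2, EA2⟩ := integral_G_coord_mul_fderiv x₀ hA hA0 hA1 ht h10      -- `∫G y₁ ∂₀ψ_A = (1/2t)∫G y₀y₁ψ_A`
  obtain ⟨IB1, JB1, EB1⟩ := integral_G_coord_mul_fderiv x₀ hψ1 hψ10 hψ11 ht h02   -- `∫G y₀ ∂₂ψ₁ = (1/2t)∫G y₂y₀ψ₁`
  obtain ⟨IB0, JB0, EB0⟩ := integral_G_coord_mul_fderiv x₀ hψ0 hψ00 hψ01 ht h12   -- `∫G y₁ ∂₂ψ₀ = (1/2t)∫G y₂y₁ψ₀`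
  -- the two `ψ_A` integrals coincide
  have hAeq : ∫ x, heatKernel t (x - x₀) * ((x - x₀) 1 * ((x - x₀) 0 * (u x 2 * u x 2))) =
      ∫ x, heatKernel t (x - x₀) * ((x - x₀) 0 * ((x - x₀) 1 * (u x 2 * u x 2))) := by
    congr 1; funext x; ring
  -- the stretching integrand `G g ∂₂u₂` is integrable (linear growth)
  have hB0 : 0 ≤ B := (norm_nonneg _).trans (hB 0)
  have hM0 : 0 ≤ M := (norm_nonneg _).trans (hM 0)
  have hcont_g : Continuous (angMom x₀ u) := by
    unfold angMom
    have hc : ∀ i : Fin 3, Continuous fun y : EuclideanSpace ℝ (Fin 3) => (y - x₀) i := fun i =>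
      (EuclideanSpace.proj (𝕜 := ℝ) i).continuous.comp (continuous_id.sub continuous_const)
    exact ((hc 0).mul (continuous_apply3 hud.continuous 1)).sub ((hc 1).mul (continuous_apply3 hud.continuous 0))
  have hcont_D22 : Continuous fun x => fderiv ℝ u x (EuclideanSpace.single 2 1) 2 := by
    have h := continuous_fderiv_apply3 hud (hu.continuous_fderiv one_ne_zero) 2 (EuclideanSpace.single 2 1)
    refine h.congr fun x => ?_
    rw [fderiv_apply3 hud]
  have hD22 : ∀ x, |fderiv ℝ u x (EuclideanSpace.single 2 1) 2| ≤ M := fun x => by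
    have h := abs_fderiv_apply3_le hud 2 2 x
    rw [fderiv_apply3 hud] at h
    exact h.trans (hM x)
  have IS : Integrable (fun x => heatKernel t (x - x₀) * (angMom x₀ u x * fderiv ℝ u x (EuclideanSpace.single 2 1) 2)) := by
    refine integrable_G_mul_lin x₀ (hcont_g.mul hcont_D22) (a := 0) (b := 2 * B * M) (fun x => ?_) ht
    rw [norm_mul, Real.norm_eq_abs, Real.norm_eq_abs, zero_add]
    calc |angMom x₀ u x| * |fderiv ℝ u x (EuclideanSpace.single 2 1) 2| ≤ (2 * ‖x - x₀‖ * ‖u x‖) * M :=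
          mul_le_mul (abs_angMom_le x₀ u x) (hD22 x) (abs_nonneg _) (by positivity)
      _ ≤ (2 * ‖x - x₀‖ * B) * M := by gcongr; exact hB x
      _ = 2 * B * M * ‖x - x₀‖ := by ring
  -- the transport integrand `G y₂ u₂ g` is integrable (difference of the two `JB`'s)
  have hsplitJ : (fun x => heatKernel t (x - x₀) * ((x - x₀) 2 * u x 2 * angMom x₀ u x)) =
      fun x => heatKernel t (x - x₀) * ((x - x₀) 2 * ((x - x₀) 0 * (u x 2 * u x 1))) -
        heatKernel t (x - x₀) * ((x - x₀) 2 * ((x - x₀) 1 * (u x 2 * u x 0))) := by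
    funext x; simp only [angMom]; ring
  have IT : Integrable (fun x => heatKernel t (x - x₀) * ((x - x₀) 2 * u x 2 * angMom x₀ u x)) := by
    rw [hsplitJ]; exact JB1.sub JB0
  refine ⟨IS, IT, ?_⟩
  -- pointwise expansion of the tilting integrand
  have hpt : ∀ x, heatKernel t (x - x₀) * (((x - x₀) 0 * curl u x 0 + (x - x₀) 1 * curl u x 1) * u x 2) =
      (heatKernel t (x - x₀) * ((x - x₀) 0 * fderiv ℝ (fun y => u y 2 * u y 2) x (EuclideanSpace.single 1 1)) / 2 -
        heatKernel t (x - x₀) * ((x - x₀) 1 * fderiv ℝ (fun y => u y 2 * u y 2) x (EuclideanSpace.single 0 1)) / 2) -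
      ((heatKernel t (x - x₀) * ((x - x₀) 0 * fderiv ℝ (fun y => u y 2 * u y 1) x (EuclideanSpace.single 2 1)) -
          heatKernel t (x - x₀) * ((x - x₀) 1 * fderiv ℝ (fun y => u y 2 * u y 0) x (EuclideanSpace.single 2 1))) -
        heatKernel t (x - x₀) * (angMom x₀ u x * fderiv ℝ u x (EuclideanSpace.single 2 1) 2)) := by
    intro x
    have hc0 : curl u x 0 = fderiv ℝ u x (EuclideanSpace.single 1 1) 2 - fderiv ℝ u x (EuclideanSpace.single 2 1) 1 := by
      simp [curl]
    have hc1 : curl u x 1 = fderiv ℝ u x (EuclideanSpace.single 2 1) 0 - fderiv ℝ u x (EuclideanSpace.single 0 1) 2 := by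
      simp [curl]
    rw [hc0, hc1, fderiv_comp_mul_comp hud 2 2, fderiv_comp_mul_comp hud 2 2, fderiv_comp_mul_comp hud 2 1,
      fderiv_comp_mul_comp hud 2 0]
    simp only [angMom]
    ring
  have hfun : (fun x => heatKernel t (x - x₀) * (((x - x₀) 0 * curl u x 0 + (x - x₀) 1 * curl u x 1) * u x 2)) =
      fun x => (heatKernel t (x - x₀) * ((x - x₀) 0 * fderiv ℝ (fun y => u y 2 * u y 2) x (EuclideanSpace.single 1 1)) / 2 -
        heatKernel t (x - x₀) * ((x - x₀) 1 * fderiv ℝ (fun y => u y 2 * u y 2) x (EuclideanSpace.single 0 1)) / 2) -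
      ((heatKernel t (x - x₀) * ((x - x₀) 0 * fderiv ℝ (fun y => u y 2 * u y 1) x (EuclideanSpace.single 2 1)) -
          heatKernel t (x - x₀) * ((x - x₀) 1 * fderiv ℝ (fun y => u y 2 * u y 0) x (EuclideanSpace.single 2 1))) -
        heatKernel t (x - x₀) * (angMom x₀ u x * fderiv ℝ u x (EuclideanSpace.single 2 1) 2)) := funext hpt
  have J1 : Integrable (fun x => heatKernel t (x - x₀) *
      ((x - x₀) 0 * fderiv ℝ (fun y => u y 2 * u y 2) x (EuclideanSpace.single 1 1)) / 2) := IA1.div_const 2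
  have J2 : Integrable (fun x => heatKernel t (x - x₀) *
      ((x - x₀) 1 * fderiv ℝ (fun y => u y 2 * u y 2) x (EuclideanSpace.single 0 1)) / 2) := IA2.div_const 2
  have J12 : Integrable (fun x =>
      heatKernel t (x - x₀) * ((x - x₀) 0 * fderiv ℝ (fun y => u y 2 * u y 2) x (EuclideanSpace.single 1 1)) / 2 -
        heatKernel t (x - x₀) * ((x - x₀) 1 * fderiv ℝ (fun y => u y 2 * u y 2) x (EuclideanSpace.single 0 1)) / 2) :=
    J1.sub J2
  have J34 : Integrable (fun x =>
      heatKernel t (x - x₀) * ((x - x₀) 0 * fderiv ℝ (fun y => u y 2 * u y 1) x (EuclideanSpace.single 2 1)) -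
        heatKernel t (x - x₀) * ((x - x₀) 1 * fderiv ℝ (fun y => u y 2 * u y 0) x (EuclideanSpace.single 2 1))) :=
    IB1.sub IB0
  have J345 : Integrable (fun x =>
      (heatKernel t (x - x₀) * ((x - x₀) 0 * fderiv ℝ (fun y => u y 2 * u y 1) x (EuclideanSpace.single 2 1)) -
          heatKernel t (x - x₀) * ((x - x₀) 1 * fderiv ℝ (fun y => u y 2 * u y 0) x (EuclideanSpace.single 2 1))) -
        heatKernel t (x - x₀) * (angMom x₀ u x * fderiv ℝ u x (EuclideanSpace.single 2 1) 2)) :=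
    J34.sub IS
  rw [hfun, integral_sub J12 J345, integral_sub J1 J2, integral_sub J34 IS, integral_sub IB1 IB0,
    integral_div, integral_div, EA1, EA2, EB1, EB0, hAeq, hsplitJ, integral_sub JB1 JB0]
  ring

end Kinematics


/-! ### At the Gaussian-extremal point -/

variable {C : ℝ}

/-- **THE EXTREMAL ENEMY STRETCHES ITS ANGULAR MOMENTUM.**  If some closed-hemisphere door-class profile (Type-I constant `C`) has
`⟪curl v(s₁)(y₁), e₃⟫ > 0` somewhere, there is a closed-hemisphere door-class `W` (constant `C`) whose slice `u = W(−1)`, with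
`g = angMom 0 u = x₀u₁ − x₁u₀`, `M₀ = ∫G₁ω₃ > 0`, satisfies: `∫G₁ g = 2M₀` (Gaussian Kelvin–Stokes); the stretching form of the tilting
moment `𝒯 = 𝒮 − ½𝒵` with `𝒮 = ∫G₁ g ∂₂u₂` (Gaussian correlation of angular momentum with AXIAL STRETCHING) and `𝒵 = ∫G₁ x₂u₂g`
(axial transport moment); and the window **`(2 − 2C)·M₀ ≤ 𝒮 − ½𝒵 ≤ (2 + 2C)·M₀`**. -/
theorem gaussExtremal_stretching {v : ℝ → EuclideanSpace ℝ (Fin 3) → EuclideanSpace ℝ (Fin 3)} (hv : InDoorClass C v)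
    (hsign : SignE3 v) (hpos : ∃ s < 0, ∃ y, 0 < ⟪curl (v s) y, e3⟫) :
    ∃ W : ℝ → EuclideanSpace ℝ (Fin 3) → EuclideanSpace ℝ (Fin 3), InDoorClass C W ∧ SignE3 W ∧
      0 < ∫ y, heatKernel 1 y * curl (W (-1)) y 2 ∧
      ∫ y, heatKernel 1 y * angMom 0 (W (-1)) y = 2 * ∫ y, heatKernel 1 y * curl (W (-1)) y 2 ∧
      ∫ y, heatKernel 1 y * ((y 0 * curl (W (-1)) y 0 + y 1 * curl (W (-1)) y 1) * W (-1) y 2) =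
        (∫ y, heatKernel 1 y * (angMom 0 (W (-1)) y * fderiv ℝ (W (-1)) y (EuclideanSpace.single 2 1) 2)) -
          1 / 2 * ∫ y, heatKernel 1 y * (y 2 * W (-1) y 2 * angMom 0 (W (-1)) y) ∧
      (2 - 2 * C) * ∫ y, heatKernel 1 y * curl (W (-1)) y 2 ≤
        (∫ y, heatKernel 1 y * (angMom 0 (W (-1)) y * fderiv ℝ (W (-1)) y (EuclideanSpace.single 2 1) 2)) -
          1 / 2 * ∫ y, heatKernel 1 y * (y 2 * W (-1) y 2 * angMom 0 (W (-1)) y) ∧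
      (∫ y, heatKernel 1 y * (angMom 0 (W (-1)) y * fderiv ℝ (W (-1)) y (EuclideanSpace.single 2 1) 2)) -
          1 / 2 * ∫ y, heatKernel 1 y * (y 2 * W (-1) y 2 * angMom 0 (W (-1)) y) ≤
        (2 + 2 * C) * ∫ y, heatKernel 1 y * curl (W (-1)) y 2 := by
  obtain ⟨W, hW, hWs, h0, -, -, hlo, hhi⟩ := gaussExtremal_tilting_sharp hv hsign hpos
  have hm1 : (-1 : ℝ) < 0 := by norm_num
  have hrate := hW.1
  have hcont := hW.2.1
  have hmild := hW.2.2.1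
  obtain ⟨K₁, -, hK₁⟩ := exists_fderiv_rate_of_class' hrate hcont hmild
  have hA : AnalyticOnNhd ℝ (W (-1)) univ := analyticOnNhd_slice hcont (bdd_of_hasTypeITimeDecay hrate) hmild hm1
  have hu : ContDiff ℝ 1 (W (-1)) := contDiff_iff_contDiffAt.2 fun x => (hA x (mem_univ x)).contDiffAt
  have hB : ∀ x, ‖W (-1) x‖ ≤ C := fun x => by
    have h := hrate (-1) hm1 x; rwa [neg_neg, Real.sqrt_one, div_one] at h
  have hM : ∀ x, ‖fderiv ℝ (W (-1)) x‖ ≤ K₁ / (-(-1)) := hK₁ (-1) hm1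
  -- the stretching identity and Kelvin–Stokes at `(t, x₀) = (1, 0)`
  obtain ⟨-, -, hE⟩ := gaussTilting_eq_stretching 0 hu hB hM one_pos
  have hKS := integral_G_angMom_eq (hu.differentiable one_ne_zero) (hu.continuous_fderiv one_ne_zero) hB hM one_pos 0
  simp only [sub_zero, mul_one] at hE hKS
  refine ⟨W, hW, hWs, h0, hKS, hE, ?_, ?_⟩
  · rw [← hE]; exact hlo
  · rw [← hE]; exact hhi

/-- **REDUCTION: W6 from the stretching window.**  If no closed-hemisphere door-class profile has, at `(1, −1, 0)`, positive Gaussian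
vertical vorticity and Gaussian angular-momentum stretching `𝒮 − ½𝒵` in the window `[(2 − 2C)M₀, (2 + 2C)M₀]`, then
`HemisphereLiouvilleE3` holds. -/
theorem hemisphereLiouvilleE3_of_stretching
    (h : ∀ (C : ℝ) (W : ℝ → EuclideanSpace ℝ (Fin 3) → EuclideanSpace ℝ (Fin 3)), InDoorClass C W → SignE3 W →
      0 < ∫ y, heatKernel 1 y * curl (W (-1)) y 2 →
      (2 - 2 * C) * ∫ y, heatKernel 1 y * curl (W (-1)) y 2 ≤
        (∫ y, heatKernel 1 y * (angMom 0 (W (-1)) y * fderiv ℝ (W (-1)) y (EuclideanSpace.single 2 1) 2)) -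
          1 / 2 * ∫ y, heatKernel 1 y * (y 2 * W (-1) y 2 * angMom 0 (W (-1)) y) →
      (∫ y, heatKernel 1 y * (angMom 0 (W (-1)) y * fderiv ℝ (W (-1)) y (EuclideanSpace.single 2 1) 2)) -
          1 / 2 * ∫ y, heatKernel 1 y * (y 2 * W (-1) y 2 * angMom 0 (W (-1)) y) ≤
        (2 + 2 * C) * ∫ y, heatKernel 1 y * curl (W (-1)) y 2 → False) :
    HemisphereLiouvilleE3 := by
  intro C v hrate hcont hmild hdiv hsign s hs y
  by_contra hne
  have hpos : 0 < ⟪curl (v s) y, e3⟫ := lt_of_le_of_ne (hsign s hs y) (Ne.symm hne)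
  obtain ⟨W, hW, hWs, h0, -, -, h1, h2⟩ := gaussExtremal_stretching (C := C) ⟨hrate, hcont, hmild, hdiv⟩ hsign ⟨s, hs, y, hpos⟩
  exact h C W hW hWs h0 h1 h2

/-- **The crux from the stretching window** (composition with the landed plumbing `stub_rotate`). -/
theorem circulationCarryingRigidity_of_stretching
    (h : ∀ (C : ℝ) (W : ℝ → EuclideanSpace ℝ (Fin 3) → EuclideanSpace ℝ (Fin 3)), InDoorClass C W → SignE3 W →
      0 < ∫ y, heatKernel 1 y * curl (W (-1)) y 2 →
      (2 - 2 * C) * ∫ y, heatKernel 1 y * curl (W (-1)) y 2 ≤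
        (∫ y, heatKernel 1 y * (angMom 0 (W (-1)) y * fderiv ℝ (W (-1)) y (EuclideanSpace.single 2 1) 2)) -
          1 / 2 * ∫ y, heatKernel 1 y * (y 2 * W (-1) y 2 * angMom 0 (W (-1)) y) →
      (∫ y, heatKernel 1 y * (angMom 0 (W (-1)) y * fderiv ℝ (W (-1)) y (EuclideanSpace.single 2 1) 2)) -
          1 / 2 * ∫ y, heatKernel 1 y * (y 2 * W (-1) y 2 * angMom 0 (W (-1)) y) ≤
        (2 + 2 * C) * ∫ y, heatKernel 1 y * curl (W (-1)) y 2 → False) :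
    CirculationCarryingRigidity :=
  circulationCarryingRigidity_of_hemisphereLiouvilleE3 (hemisphereLiouvilleE3_of_stretching h)

end Summit.NavierStokesRegularity.NavierStokesRegularity.Theorems.HalfSpaceWindowDoorCirculationCarryingRigidityGaussExtremalStretching

end
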